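import Literature.AlgebraicGeometry.ShimuraVarieties.UnitaryCurveSiegelStationarity
import Literature.AlgebraicGeometry.ShimuraVarieties.UnitaryCurveSiegelChart
import Literature.AlgebraicGeometry.ShimuraVarieties.UnitaryCurveSiegelBorel
import Literature.AlgebraicGeometry.ModuliOfAbelianVarieties.SiegelFineModuliSchemeExists
import Literature.AlgebraicGeometry.HodgeTheory.QuasiProjectiveSeparatedOfField
import HarnessLib

/-!
# The Siegel shadow of the unitary Shimura curve is INJECTIVE at every sufficiently deep `b`-saturated level ([Deligne 1971] Prop. 1.15)

Topic `AlgebraicGeometry/ShimuraVarieties`; namespace `Literature.AlgebraicGeometry.ShimuraVarieties.UnitaryCurve`.  THEOREMS ONLY (no `def`, no named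
fact, no instance, no `sorry`).  Cell `hodgecm-mathlib`, crux HLiu418 (stmt-HodgeConjecture-24832), sub-line P6a, E-line `F0_P6a_PELWitnessE`, organ «DELIGNE 1.15 AT
PRINCIPAL LEVEL» (LEAD F0P6-plan (g3) «M-52»), the CHART-FREE CONCLUSION consumed by E-line ED. 5's `sep` export: the sequel of ★ `UnitaryCurveSiegelStationarity`
(`exists_forall_le_siegelPointMap_injective`: one deep Siegel level classifies, GIVEN separated-target morphisms `f_k` with the level-`N₀(k+1)!` fibre law)
in which the `f_k` are PRODUCED — from the two (proved, here hypotheses) printed Siegel facts (F) ★ `lan2013_siegelFineModuliScheme` and (U) ★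
`siegelModuli_complexUniformisation`, the chart ★ FILE C `UnitaryCurve.exists_siegelChartGS` at every level of the factorial tower, and Borel∕GAGA ★ E4
`RecordSystemGS.exists_hom_of_holomorphicSiegelLifts` — and then DISCARDED: what remains is a statement about the datum `(S, J, b, bq)` alone.

THE DATUM (hypotheses = the `AuxChartGS` datum fields of the E-line, N-free): `J hJ hJneg hJsmul b bq hb hJrat hJinj hbrat hbcont hZ`, `0 < g`, `δ` a polarisation type, a
small level `K ≤ b⁻¹K_δ(N₀)` with `N₀ ≥ 3`.

WHAT IS PROVED.
* `exists_forall_le_siegelShadow_separates` — THERE IS `k₀` SUCH THAT FOR EVERY `k ≥ k₀`: level-`N₀(k+1)!` Siegel equality `[J v, b a] = [J v′, b a′]` forces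
  `[v, a] = [v′, a′]` in `Sh_{K ⊓ b⁻¹K_δ(N₀(k+1)!)}(U(J⋆), 𝔻)(ℂ)` (and in `Sh_K(ℂ)`) — [Deligne1971TravauxShimura] Prop. 1.15 for `U(J⋆) ↪ GSp_δ` at principal levels.
  Proof: at each level `k` take `𝓜_k` from (F), the chart `(Sc, ιc, unif, f, piece, Z, …, pts)` from ★ FILE C and `ψ_k` from ★ E4; the fibre law
  `ψ_k ⟦v, a⟧ = ψ_k ⟦v′, a′⟧ ↔ [J v, b a]_{N₀(k+1)!} = [J v′, b a′]` follows from E4's point formula, FILE C's shadow law `f_pts` and the bijection `pts`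
  (`map_eq_map_iff_siegel_mk_eq_of_pointFormula`); then ★ `exists_forall_le_siegelPointMap_injective`.
* `injective_of_shadow_formula` — at such a level ANY map `φ` on `Sh_{K ⊓ b⁻¹K_δ(N₀(k+1)!)}(ℂ)` with a Siegel-shadow formula `σ (φ [v, a]) = [J v, b a]` (e.g. an
  `AuxChartGS` point map `C.f` with `σ := C.pts ∘ baseChangeEquiv`, law `C.f_pts`) is INJECTIVE — the one-line `sep` closer of E-line ED. 5 before ★
  `RecordSystemGS.algPoints_map_injective_of_sliceDescent`.

HC_CM is proved only modulo the 2 remaining named inputs (hLiu418 24832, h413 24833) until rung 0 closes; this file discharges neither (count-neutral support of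
24832; (F) and (U) enter as hypotheses and are discharged in the E-line by ★ `lan2013_siegelFineModuliScheme_holds` ∕ ★ `siegelModuli_complexUniformisation_holds`).

## References
* [Deligne1971TravauxShimura] P. Deligne, *Travaux de Shimura*, Sém. Bourbaki 389 (1971), Prop. 1.15 with its proof p. 132, 4.11–4.12 p. 148.
* [Milne2005ShimuraVarieties] J. S. Milne, *Introduction to Shimura varieties* (2005; rev. 2017), Lemma 5.13 p. 57, Thm. 5.17 p. 59, Thm. 3.14.
* [Deligne1979ShimuraVarieties] P. Deligne, *Variétés de Shimura* (1979), Prop. 2.3.10, 2.1.2.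
* [Borel1972ExtensionTheorem] A. Borel, *Some metric properties of arithmetic quotients…* (1972), Thm. 3.10 p. 559.
-/

set_option autoImplicit false

noncomputable section

open Function Matrix NumberField IsDedekindDomain CategoryTheory CategoryTheory.Limits AlgebraicGeometry
open scoped Matrix ComplexOrder
open Literature.AlgebraicGeometry.Motives
open Literature.NumberTheory.Automorphic (siegelUpperHalfSpace)
open Literature.NumberTheory.Automorphic.UnitaryGroup
open Literature.NumberTheory.Automorphic.Liu2021.AppendixC (C5.OpenCompactSubgroup C5.SmallLevel)
open Literature.AlgebraicGeometry.HodgeTheory (IsQuasiProjectiveOver)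

namespace Literature.AlgebraicGeometry.ShimuraVarieties

open Literature.AlgebraicGeometry.ModuliOfAbelianVarieties
open Literature.AlgebraicGeometry.ModuliOfAbelianVarieties.SiegelModuli (C0 jOfSiegel jOfSiegel_mem_C0)
open UnitaryCanonicalModel

namespace UnitaryCurve

variable {L : Type} [Field L] [NumberField L] [IsCMField L] {Jstar : Matrix (Fin 2) (Fin 2) L} {τ : L →+* ℂ}
variable {K₀ : C5.OpenCompactSubgroup ↥(finAdelic (↥(maximalRealSubfield L)) L (IsCMField.complexConj L) 2 Jstar)}
variable {g : ℕ} {δ : Fin g → ℕ}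
variable (S : RecordSystemGS L Jstar τ K₀)
variable (J : (Fin 2 → ℂ) → Matrix (Fin g ⊕ Fin g) (Fin g ⊕ Fin g) ℝ)
  (hJ : ∀ v : Fin 2 → ℂ, v ∈ negCone (Jstar.map τ) → J v ∈ C0pm δ)
  (b : ↥(finAdelic (↥(maximalRealSubfield L)) L (IsCMField.complexConj L) 2 Jstar) →* ↥(gspFinAdelic δ))
  (bq : ↥(rational (↥(maximalRealSubfield L)) L (IsCMField.complexConj L) 2 Jstar) →* ↥(gspRational δ))

/-! ### §1. Point bookkeeping: a shadow formula makes injectivity a Shimura-set statement; E4's point formula gives the fibre law -/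

/-- **Injectivity from a shadow formula**: if `σ (φ [v, a]) = [J v, b a]_{K_δ(N)}` for all representatives and level-`N` Siegel equality separates `Sh_{K'}`, then
`φ` is injective on `Sh_{K'}(ℂ)` (for an `AuxChartGS` point map: `φ := C.f`, `σ := C.pts ∘ AlgPoints.baseChangeEquiv (algebraMap ℚ ℂ) C.𝓜.M`, the law `C.f_pts`).
[cite: Deligne1971TravauxShimura, Prop. 1.15 p. 132] [cite: Milne2005ShimuraVarieties, Thm. 5.17 p. 59] -/
theorem injective_of_shadow_formula {N : ℕ}
    (K' : Subgroup ↥(finAdelic (↥(maximalRealSubfield L)) L (IsCMField.complexConj L) 2 Jstar))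
    (hsep : ∀ (v v' : Fin 2 → ℂ) (hv : v ∈ negCone (Jstar.map τ)) (hv' : v' ∈ negCone (Jstar.map τ))
      (a a' : ↥(finAdelic (↥(maximalRealSubfield L)) L (IsCMField.complexConj L) 2 Jstar)),
      SiegelShimuraSet.mk δ (principalLevelSubgroup δ N) ⟨J v, hJ v hv⟩ (b a) =
          SiegelShimuraSet.mk δ (principalLevelSubgroup δ N) ⟨J v', hJ v' hv'⟩ (b a') →
        ShimuraSetGS.mk L Jstar τ K' v hv a = ShimuraSetGS.mk L Jstar τ K' v' hv' a')
    {Y : Type*} (φ : ShimuraSetGS L Jstar τ K' → Y) (σ : Y → SiegelShimuraSet δ (principalLevelSubgroup δ N))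
    (hφ : ∀ (v : Fin 2 → ℂ) (hv : v ∈ negCone (Jstar.map τ)) (a : ↥(finAdelic (↥(maximalRealSubfield L)) L (IsCMField.complexConj L) 2 Jstar)),
      σ (φ (ShimuraSetGS.mk L Jstar τ K' v hv a)) = SiegelShimuraSet.mk δ (principalLevelSubgroup δ N) ⟨J v, hJ v hv⟩ (b a)) :
    Function.Injective φ := by
  intro x y hxy
  obtain ⟨v, hv, a, rfl⟩ := ShimuraSetGS.mk_surjective L Jstar τ K' x
  obtain ⟨v', hv', a', rfl⟩ := ShimuraSetGS.mk_surjective L Jstar τ K' y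
  have h := congrArg σ hxy
  rw [hφ, hφ] at h
  exact hsep v v' hv hv' a a' h

/-- **E4's point formula ⇒ the fibre law.**  If `ψ : (S.M K')_τ ⟶ M ⊗_ℚ ℂ` satisfies E4's point formula `(ψ ⟦P⟧) ≫ pr₁ = f (pts P)` (★
`RecordSystemGS.exists_hom_of_holomorphicSiegelLifts`) and `f` has the Siegel shadow `pts_M (f [v, a])_ℂ = [J v, b a]_{K_δ(N)}` through a bijection `pts_M` (★ FILE C `f_pts`), then
`ψ ⟦v, a⟧ = ψ ⟦v′, a′⟧ ↔ [J v, b a]_{K_δ(N)} = [J v′, b a′]_{K_δ(N)}` — the hypothesis `hf` of ★ `exists_forall_le_siegelPointMap_injective`.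
[cite: Deligne1979ShimuraVarieties, Prop. 2.3.10] [cite: Milne2005ShimuraVarieties, Lemma 5.13 p. 57] -/
theorem map_eq_map_iff_siegel_mk_eq_of_pointFormula {N : ℕ} (K' : C5.SmallLevel K₀) (M : SchemeOver ℚ)
    (f : ShimuraSetGS L Jstar τ K'.1.1 → ComplexPoints M)
    (ptsM : ComplexPoints ((Motives.baseChange ℚ ℂ).obj M) ≃ SiegelShimuraSet δ (principalLevelSubgroup δ N))
    (f_pts : ∀ (v : Fin 2 → ℂ) (hv : v ∈ negCone (Jstar.map τ))
      (a : ↥(finAdelic (↥(maximalRealSubfield L)) L (IsCMField.complexConj L) 2 Jstar)),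
      ptsM (AlgPoints.baseChangeEquiv (algebraMap ℚ ℂ) M (f (ShimuraSetGS.mk L Jstar τ K'.1.1 v hv a))) =
        SiegelShimuraSet.mk δ (principalLevelSubgroup δ N) ⟨J v, hJ v hv⟩ (b a))
    (ψ : (baseChangeHom τ).obj (S.M.obj K') ⟶ (Motives.baseChange ℚ ℂ).obj M)
    (hψ : letI := τ.toAlgebra
      ∀ P : ComplexPoints (S.M.obj K'),
        (AlgPoints.map ψ (AlgPoints.baseChangeEquiv τ (S.M.obj K') P)).left ≫ baseChangeHomFst (algebraMap ℚ ℂ) M = (f (S.pts K' P)).left) :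
    letI := τ.toAlgebra
    ∀ (v : Fin 2 → ℂ) (hv : v ∈ negCone (Jstar.map τ)) (a : ↥(finAdelic (↥(maximalRealSubfield L)) L (IsCMField.complexConj L) 2 Jstar))
      (v' : Fin 2 → ℂ) (hv' : v' ∈ negCone (Jstar.map τ)) (a' : ↥(finAdelic (↥(maximalRealSubfield L)) L (IsCMField.complexConj L) 2 Jstar)),
      AlgPoints.map ψ (AlgPoints.baseChangeEquiv τ (S.M.obj K') ((S.pts K').symm (ShimuraSetGS.mk L Jstar τ K'.1.1 v hv a))) =
          AlgPoints.map ψ (AlgPoints.baseChangeEquiv τ (S.M.obj K') ((S.pts K').symm (ShimuraSetGS.mk L Jstar τ K'.1.1 v' hv' a'))) ↔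
        SiegelShimuraSet.mk δ (principalLevelSubgroup δ N) ⟨J v, hJ v hv⟩ (b a) =
          SiegelShimuraSet.mk δ (principalLevelSubgroup δ N) ⟨J v', hJ v' hv'⟩ (b a') := by
  letI : Algebra L ℂ := τ.toAlgebra
  -- the value of `ψ` at `⟦v, a⟧`, read back in `M(ℂ)`, is `f [v, a]`
  have hval : ∀ (v : Fin 2 → ℂ) (hv : v ∈ negCone (Jstar.map τ))
      (a : ↥(finAdelic (↥(maximalRealSubfield L)) L (IsCMField.complexConj L) 2 Jstar)),
      (AlgPoints.baseChangeEquiv (algebraMap ℚ ℂ) M).symm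
          (AlgPoints.map ψ (AlgPoints.baseChangeEquiv τ (S.M.obj K') ((S.pts K').symm (ShimuraSetGS.mk L Jstar τ K'.1.1 v hv a)))) =
        f (ShimuraSetGS.mk L Jstar τ K'.1.1 v hv a) := by
    intro v hv a
    apply Over.OverMorphism.ext
    rw [AlgPoints.baseChangeEquiv_symm_apply_left]
    have h := hψ ((S.pts K').symm (ShimuraSetGS.mk L Jstar τ K'.1.1 v hv a))
    rw [Homeomorph.apply_symm_apply] at h
    exact h
  have hval' : ∀ (v : Fin 2 → ℂ) (hv : v ∈ negCone (Jstar.map τ))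
      (a : ↥(finAdelic (↥(maximalRealSubfield L)) L (IsCMField.complexConj L) 2 Jstar)),
      AlgPoints.map ψ (AlgPoints.baseChangeEquiv τ (S.M.obj K') ((S.pts K').symm (ShimuraSetGS.mk L Jstar τ K'.1.1 v hv a))) =
        AlgPoints.baseChangeEquiv (algebraMap ℚ ℂ) M (f (ShimuraSetGS.mk L Jstar τ K'.1.1 v hv a)) := fun v hv a => by
    have h := hval v hv a
    rw [Equiv.symm_apply_eq] at h
    exact h
  intro v hv a v' hv' a'
  rw [hval', hval', ← f_pts v hv a, ← f_pts v' hv' a']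
  constructor
  · intro h; rw [h]
  · intro h; exact ptsM.injective h

/-! ### §2. [Deligne 1971] Prop. 1.15: the Siegel shadow separates `Sh_{K ⊓ b⁻¹K_δ(N₀(k+1)!)}(ℂ)` for all `k ≥ k₀` -/

include S in
/-- **THE SIEGEL SHADOW IS INJECTIVE AT EVERY SUFFICIENTLY DEEP `b`-SATURATED LEVEL** ([Deligne1971TravauxShimura] Prop. 1.15 for `U(J⋆) ↪ GSp_δ`, principal
levels; chart-free conclusion).  For the datum `(S, J, b, bq)` with its laws, `0 < g`, `δ` a polarisation type, `K ≤ b⁻¹K_δ(N₀)` small with `N₀ ≥ 3`, and the printed Siegel facts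
(F) `lan2013_siegelFineModuliScheme`, (U) `siegelModuli_complexUniformisation` (both PROVED in the cell; hypotheses here): THERE IS `k₀` such that for every `k ≥ k₀`,
`[J v, b a]_{K_δ(N₀(k+1)!)} = [J v′, b a′]_{K_δ(N₀(k+1)!)}` forces `[v, a] = [v′, a′]` in `Sh_{K ⊓ b⁻¹K_δ(N₀(k+1)!)}(ℂ)` and in `Sh_K(ℂ)`.  Proof: the charts of ★ FILE C and
the morphisms of ★ E4 at every tower level feed ★ `exists_forall_le_siegelPointMap_injective` (fibre law by `map_eq_map_iff_siegel_mk_eq_of_pointFormula`).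
[cite: Deligne1971TravauxShimura, Prop. 1.15 with its proof p. 132] [cite: Milne2005ShimuraVarieties, Thm. 5.17 p. 59, Lemma 5.13 p. 57]
[cite: Borel1972ExtensionTheorem, Thm. 3.10 p. 559] [cite: Deligne1979ShimuraVarieties, Prop. 2.3.10] -/
theorem exists_forall_le_siegelShadow_separates (hF : lan2013_siegelFineModuliScheme) (hU : siegelModuli_complexUniformisation)
    (hg : 0 < g) (hδ : IsPolarizationType δ)
    (hJneg : ∀ v : Fin 2 → ℂ, v ∈ negCone (Jstar.map τ) → -J v ∈ C0 δ)
    (hJsmul : ∀ c : ℂ, c ≠ 0 → ∀ v : Fin 2 → ℂ, v ∈ negCone (Jstar.map τ) → J (c • v) = J v)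
    (hb : ∀ γ : ↥(rational (↥(maximalRealSubfield L)) L (IsCMField.complexConj L) 2 Jstar),
      b (rationalToFinAdelic (↥(maximalRealSubfield L)) L (IsCMField.complexConj L) 2 Jstar γ) = gspRationalToFinAdelic δ (bq γ))
    (hJrat : ∀ (γ : ↥(rational (↥(maximalRealSubfield L)) L (IsCMField.complexConj L) 2 Jstar)) (v : Fin 2 → ℂ),
      v ∈ negCone (Jstar.map τ) →
        J (((ratToGLℂ L Jstar τ γ : GL (Fin 2) ℂ) : Matrix (Fin 2) (Fin 2) ℂ) *ᵥ v) =
          conjJ ((gspRationalToReal δ (bq γ) : ↥(gspReal δ)) : GL (Fin g ⊕ Fin g) ℝ) (J v))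
    (hJinj : ∀ v : Fin 2 → ℂ, v ∈ negCone (Jstar.map τ) → ∀ v' : Fin 2 → ℂ, v' ∈ negCone (Jstar.map τ) →
      J v = J v' → ∃ c : ℂ, c ≠ 0 ∧ c • v' = v)
    (hbrat : ∀ (γ : ↥(gspRational δ)) (x : ↥(finAdelic (↥(maximalRealSubfield L)) L (IsCMField.complexConj L) 2 Jstar)),
      gspRationalToFinAdelic δ γ = b x →
        ∃ β : ↥(rational (↥(maximalRealSubfield L)) L (IsCMField.complexConj L) 2 Jstar),
          x = rationalToFinAdelic (↥(maximalRealSubfield L)) L (IsCMField.complexConj L) 2 Jstar β ∧ γ = bq β)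
    (hbcont : Continuous b)
    (hZ : ∀ γ : GL (Fin g ⊕ Fin g) ℝ, γ ∈ gspReal δ → (∀ v : Fin 2 → ℂ, v ∈ negCone (Jstar.map τ) → conjJ γ (J v) ∈ C0 δ) →
      ∃ Z : (Fin 2 → ℂ) → Matrix (Fin g) (Fin g) ℂ,
        (∀ i j : Fin g, DifferentiableOn ℂ (fun v => Z v i j) (negCone (Jstar.map τ))) ∧
          ∀ v : Fin 2 → ℂ, v ∈ negCone (Jstar.map τ) → Z v ∈ siegelUpperHalfSpace g ∧ conjJ γ (J v) = jOfSiegel δ (Z v))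
    {N₀ : ℕ} (hN₀ : 3 ≤ N₀) (K : C5.SmallLevel K₀) (hle : K.1.1 ≤ (principalLevelSubgroup δ N₀).comap b) :
    ∃ k₀ : ℕ, ∀ k, k₀ ≤ k →
      (∀ (v v' : Fin 2 → ℂ) (hv : v ∈ negCone (Jstar.map τ)) (hv' : v' ∈ negCone (Jstar.map τ))
        (a a' : ↥(finAdelic (↥(maximalRealSubfield L)) L (IsCMField.complexConj L) 2 Jstar)),
        SiegelShimuraSet.mk δ (principalLevelSubgroup δ (N₀ * (k + 1).factorial)) ⟨J v, hJ v hv⟩ (b a) =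
            SiegelShimuraSet.mk δ (principalLevelSubgroup δ (N₀ * (k + 1).factorial)) ⟨J v', hJ v' hv'⟩ (b a') →
          ShimuraSetGS.mk L Jstar τ (K.1.1 ⊓ (principalLevelSubgroup δ (N₀ * (k + 1).factorial)).comap b) v hv a =
            ShimuraSetGS.mk L Jstar τ (K.1.1 ⊓ (principalLevelSubgroup δ (N₀ * (k + 1).factorial)).comap b) v' hv' a') ∧
      (∀ (v v' : Fin 2 → ℂ) (hv : v ∈ negCone (Jstar.map τ)) (hv' : v' ∈ negCone (Jstar.map τ))
        (a a' : ↥(finAdelic (↥(maximalRealSubfield L)) L (IsCMField.complexConj L) 2 Jstar)),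
        SiegelShimuraSet.mk δ (principalLevelSubgroup δ (N₀ * (k + 1).factorial)) ⟨J v, hJ v hv⟩ (b a) =
            SiegelShimuraSet.mk δ (principalLevelSubgroup δ (N₀ * (k + 1).factorial)) ⟨J v', hJ v' hv'⟩ (b a') →
          ShimuraSetGS.mk L Jstar τ K.1.1 v hv a = ShimuraSetGS.mk L Jstar τ K.1.1 v' hv' a') := by
  letI : Algebra L ℂ := τ.toAlgebra
  classical
  have hN₀0 : N₀ ≠ 0 := by omega
  -- the levels `N_k = N₀(k+1)! ≥ 3` and the saturated small levels `K_k = K ⊓ b⁻¹K_δ(N_k)`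
  have hNk : ∀ k : ℕ, 3 ≤ N₀ * (k + 1).factorial := fun k =>
    hN₀.trans (Nat.le_mul_of_pos_right N₀ (Nat.factorial_pos _))
  have hNk0 : ∀ k : ℕ, N₀ * (k + 1).factorial ≠ 0 := fun k => by have := hNk k; omega
  set Kt : ℕ → C5.SmallLevel K₀ := fun k =>
    ⟨⟨K.1.1 ⊓ (principalLevelSubgroup δ (N₀ * (k + 1).factorial)).comap b,
      isOpen_inf_comap_principalLevelSubgroup b hbcont (hNk0 k) K.1.1 K.1.2.1,
      isCompact_inf_comap_principalLevelSubgroup b hbcont (hNk0 k) K.1.1 K.1.2.2⟩,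
      le_trans (inf_le_left : K.1.1 ⊓ (principalLevelSubgroup δ (N₀ * (k + 1).factorial)).comap b ≤ K.1.1) K.2⟩ with hKtdef
  have hKt : ∀ k, (Kt k).1.1 = K.1.1 ⊓ (principalLevelSubgroup δ (N₀ * (k + 1).factorial)).comap b := fun _ => rfl
  have hleK : ∀ k, (Kt k).1.1 ≤ (principalLevelSubgroup δ (N₀ * (k + 1).factorial)).comap b := fun k => by
    rw [hKt k]; exact inf_le_right
  -- §a at every level: the Siegel target (F), the chart (FILE C over (U)), the GAGA morphism (E4) and its fibre law
  have hlevel : ∀ k : ℕ, ∃ (𝓜 : SiegelFineModuliScheme g (N₀ * (k + 1).factorial) δ)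
      (ψ : (baseChangeHom τ).obj (S.M.obj (Kt k)) ⟶ (Motives.baseChange ℚ ℂ).obj 𝓜.M),
      IsSeparated ((Motives.baseChange ℚ ℂ).obj 𝓜.M).hom ∧
      ∀ (v : Fin 2 → ℂ) (hv : v ∈ negCone (Jstar.map τ)) (a : ↥(finAdelic (↥(maximalRealSubfield L)) L (IsCMField.complexConj L) 2 Jstar))
        (v' : Fin 2 → ℂ) (hv' : v' ∈ negCone (Jstar.map τ)) (a' : ↥(finAdelic (↥(maximalRealSubfield L)) L (IsCMField.complexConj L) 2 Jstar)),
        AlgPoints.map ψ (AlgPoints.baseChangeEquiv τ (S.M.obj (Kt k)) ((S.pts (Kt k)).symm (ShimuraSetGS.mk L Jstar τ (Kt k).1.1 v hv a))) =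
            AlgPoints.map ψ (AlgPoints.baseChangeEquiv τ (S.M.obj (Kt k)) ((S.pts (Kt k)).symm (ShimuraSetGS.mk L Jstar τ (Kt k).1.1 v' hv' a'))) ↔
          SiegelShimuraSet.mk δ (principalLevelSubgroup δ (N₀ * (k + 1).factorial)) ⟨J v, hJ v hv⟩ (b a) =
            SiegelShimuraSet.mk δ (principalLevelSubgroup δ (N₀ * (k + 1).factorial)) ⟨J v', hJ v' hv'⟩ (b a') := by
    intro k
    obtain ⟨𝓜, hsmooth, hqp, -⟩ := hF g (N₀ * (k + 1).factorial) δ hg hδ (hNk k)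
    obtain ⟨Sc, ιc, unif, f, piece, Z, u, rep, pts, -, -, hcont, -, -, -, hhol, -, hZd, hZm, hfmk, hptsf, -⟩ :=
      exists_siegelChartGS hU hg hδ (hNk k) 𝓜 J hJ hJneg hJsmul b bq hb hJrat (Kt k).1.1 (hleK k) hZ
    haveI : Smooth 𝓜.M.hom := hsmooth
    obtain ⟨ψ, hψ⟩ := S.exists_hom_of_holomorphicSiegelLifts (Kt k) 𝓜.M hqp Sc ιc unif hcont hhol f piece Z hZd hZm hfmk
    refine ⟨𝓜, ψ, IsQuasiProjectiveOver.hom_isSeparated (IsQuasiProjectiveOver.baseChangeHom (algebraMap ℚ ℂ) hqp), ?_⟩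
    exact map_eq_map_iff_siegel_mk_eq_of_pointFormula S J hJ b (Kt k) 𝓜.M f pts hptsf ψ hψ
  choose 𝓜 ψ hsepA hf using hlevel
  haveI : ∀ k, IsSeparated ((Motives.baseChange ℚ ℂ).obj (𝓜 k).M).hom := hsepA
  -- §b Deligne 1.15 at principal level (★ `exists_forall_le_siegelPointMap_injective`)
  obtain ⟨k₀, hk₀⟩ := exists_forall_le_siegelPointMap_injective S J hJ b bq hJsmul hb hJrat hJinj hbrat hbcont hN₀ K hle Kt hKt
    (A := fun k => (Motives.baseChange ℚ ℂ).obj (𝓜 k).M) ψ hf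
  exact ⟨k₀, fun k hk => ⟨(hk₀ k hk).2.1, (hk₀ k hk).2.2⟩⟩

end UnitaryCurve

end Literature.AlgebraicGeometry.ShimuraVarieties

end
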